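import Literature.Geometry.Symplectic.SphereCROperatorJet
import HarnessLib

/-!
# The linearised Cauchy–Riemann operator at the zero section: coefficients

Layer B4c of the analytic core of the Hofer–Lizan–Sikorav local foliation theorem (Wendl 2018,
Thm. 2.46; lead of crux `WitnessCharge`, summit `SmoothPoincare4`). For chart data
`𝒥 : SphereACData` of an almost complex structure on `ℂℙ¹ × ℂ` along a holomorphic zero section
(`SphereACData.lean`, `SphereCROperatorPointwise.lean`) we evaluate, AT THE ZERO SECTION
`ξ = f = 0`, the first variation of the chart-`0` Cauchy–Riemann operator in the direction
`(δξ, δf)` — the expression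

  `Φ₀(z) [ D η(z) 1 + J₀(z,0) (D η(z) I) + (D J₀ (z,0) [η z]) (I, 0) ]`,
  `η z' = (δξ z', Q₀(z')⁻¹ (δf z'))`

(the shape produced by `SphereCROperatorVariation.hasDerivAt_crOp₀_variation` with
`dvmap₀ 0 δξ δf = η`). The result is UPPER TRIANGULAR with Cauchy–Riemann diagonal:

* normal row (`linearisation_zero_snd`): `∂ₓ δf + I ∂_y δf + a₀(z) (δf z)` — i.e. `2 ∂̄ δf + A δf`
  with the zeroth-order coefficient field `aCoeff₀ : ℂ → (ℂ →L[ℝ] ℂ)` (smooth,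
  `contDiff_aCoeff₀`), and NO dependence on `δξ`;
* tangent row (`linearisation_zero_fst`): `∂ₓ δξ + I ∂_y δξ + m₀(z) (δf z, D δf z)` with the
  coupling `mCoeff₀ z : ℂ × (ℂ →L[ℝ] ℂ) →L[ℝ] ℂ` (first order in `δf`, no zeroth-order term in
  `δξ`: the derivative of `J₀` along the zero section kills the axis vector, `fderiv_J₀_axis_apply`,
  because `J₀ (Z, 0) (ζ, 0) = (I ζ, 0)` for all `Z`).

This is the block structure `[[2∂̄_T, M], [0, 2∂̄_N + A]]` of the linearisation used for the
bordered isomorphism (tangential slice ⊕ automatic transversality).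

## References

* C. Wendl, *Holomorphic Curves in Low Dimensions*, LNM 2216 (2018), §2.3, Thm. 2.46. [Wendl2018]
-/

noncomputable section

open Complex Set Filter
open scoped Topology ContDiff
open Literature.Analysis.Complex.ProjectiveLineExpChart Literature.Geometry.Symplectic.CRExpression

namespace Literature.Geometry.Symplectic

namespace SphereCR

namespace SphereACData

variable (𝒥 : SphereACData)

/-! ### The derivative of `J₀` along and across the zero section -/

/-- `K₀ z s := (∂ₜ J₀ (z, 0) [s]) (I, 0)`: the derivative of the structure across the zero section
(direction `(0, s)`) applied to the axis vector `(I, 0)`. [cite: Wendl2018, Thm. 2.46] -/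
def K₀ (z : ℂ) : ℂ →L[ℝ] ℂ × ℂ :=
  (ContinuousLinearMap.apply ℝ (ℂ × ℂ) ((I : ℂ), (0 : ℂ))).comp
    ((fderiv ℝ 𝒥.J₀ ((z : ℂ), (0 : ℂ))).comp (ContinuousLinearMap.inr ℝ ℂ ℂ))

/-- Pointwise formula for `K₀`. [folklore] -/
@[simp] theorem K₀_apply (z s : ℂ) : 𝒥.K₀ z s = (fderiv ℝ 𝒥.J₀ (z, 0) (0, s)) (I, 0) := rfl

/-- `Z ↦ J₀ (Z, 0)` has derivative `D J₀ (z, 0) ∘ inl` at `z`. [folklore] -/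
theorem hasFDerivAt_J₀_axis (z : ℂ) :
    HasFDerivAt (fun Z : ℂ => 𝒥.J₀ (Z, 0))
      ((fderiv ℝ 𝒥.J₀ (z, 0)).comp (ContinuousLinearMap.inl ℝ ℂ ℂ)) z := by
  have hJ : HasFDerivAt 𝒥.J₀ (fderiv ℝ 𝒥.J₀ (z, 0)) ((z : ℂ), (0 : ℂ)) :=
    ((𝒥.smooth₀.differentiable (by simp)).differentiableAt).hasFDerivAt
  exact hJ.comp z (hasFDerivAt_prodMk_left z (0 : ℂ))

/-- **The derivative of `J₀` ALONG the zero section kills the axis vector**: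
`(D J₀ (z, 0) [(c, 0)]) (I, 0) = 0`, since `Z ↦ J₀ (Z, 0) (I, 0) = (I·I, 0)` is constant
(`axis₀`). [cite: Wendl2018, Thm. 2.46] -/
theorem fderiv_J₀_axis_apply (z c : ℂ) : (fderiv ℝ 𝒥.J₀ (z, 0) (c, 0)) (I, 0) = 0 := by
  have h := (𝒥.hasFDerivAt_J₀_axis z).clm_apply (hasFDerivAt_const ((I : ℂ), (0 : ℂ)) z)
  have hconst : (fun Z : ℂ => 𝒥.J₀ (Z, 0) (I, 0)) = fun _ => ((I * I, 0) : ℂ × ℂ) :=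
    funext fun Z => 𝒥.axis₀ Z I
  have h0 : fderiv ℝ (fun Z : ℂ => 𝒥.J₀ (Z, 0) (I, 0)) z = 0 := by
    rw [hconst]; exact fderiv_const_apply _
  have h1 := congrArg (fun L : ℂ →L[ℝ] ℂ × ℂ => L c) (h.fderiv.symm.trans h0)
  simpa using h1

/-- Splitting of the derivative of `J₀` at a point of the zero section applied to the axis vector:
only the normal component of the direction contributes. [cite: Wendl2018, Thm. 2.46] -/
theorem fderiv_J₀_apply_axis (z c s : ℂ) :
    (fderiv ℝ 𝒥.J₀ (z, 0) (c, s)) (I, 0) = 𝒥.K₀ z s := by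
  have h : ((c, s) : ℂ × ℂ) = (c, 0) + (0, s) := by simp
  rw [h, map_add, show ∀ (L₁ L₂ : ℂ × ℂ →L[ℝ] ℂ × ℂ) (v : ℂ × ℂ), (L₁ + L₂) v = L₁ v + L₂ v from
    fun _ _ _ => rfl, 𝒥.fderiv_J₀_axis_apply, zero_add, K₀_apply]

/-! ### The coefficient fields of the linearisation at the zero section -/

/-- **The zeroth-order coefficient of the normal row**:
`a₀(z) t = Q₀ z [ (∂ₓ Q₀⁻¹)(z) t + D₀(z) ((∂_y Q₀⁻¹)(z) t) + (K₀ z (Q₀(z)⁻¹ t)).2 ]`.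
[cite: Wendl2018, Thm. 2.46] -/
def aCoeff₀ (z : ℂ) : ℂ →L[ℝ] ℂ :=
  (𝒥.Q₀ z).comp (fderiv ℝ 𝒥.Qinv₀ z 1 + (𝒥.nrm₀ z).comp (fderiv ℝ 𝒥.Qinv₀ z I) +
    (ContinuousLinearMap.snd ℝ ℂ ℂ).comp ((𝒥.K₀ z).comp (𝒥.Qinv₀ z)))

/-- Pointwise formula for `aCoeff₀`. [folklore] -/
theorem aCoeff₀_apply (z t : ℂ) :
    𝒥.aCoeff₀ z t = 𝒥.Q₀ z ((fderiv ℝ 𝒥.Qinv₀ z 1) t + 𝒥.nrm₀ z ((fderiv ℝ 𝒥.Qinv₀ z I) t) +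
      (𝒥.K₀ z (𝒥.Qinv₀ z t)).2) := rfl

/-- The normal pre-image vector `n_e(t, t') = Q₀⁻¹ z (t' e) + (∂_e Q₀⁻¹)(z) t` as a linear map of
`(t, t')`. [folklore] -/
def nVec (z e : ℂ) : ℂ × (ℂ →L[ℝ] ℂ) →L[ℝ] ℂ :=
  (𝒥.Qinv₀ z).comp ((ContinuousLinearMap.apply ℝ ℂ e).comp
    (ContinuousLinearMap.snd ℝ ℂ (ℂ →L[ℝ] ℂ))) +
  (fderiv ℝ 𝒥.Qinv₀ z e).comp (ContinuousLinearMap.fst ℝ ℂ (ℂ →L[ℝ] ℂ))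

/-- Pointwise formula for `nVec`. [folklore] -/
@[simp] theorem nVec_apply (z e : ℂ) (x : ℂ × (ℂ →L[ℝ] ℂ)) :
    𝒥.nVec z e x = 𝒥.Qinv₀ z (x.2 e) + (fderiv ℝ 𝒥.Qinv₀ z e) x.1 := rfl

/-- The normal component (before `Q₀`) of the linearised expression as a linear map of the
`f`-jet `(t, t')`: `n₁ + D₀ n_I + (K₀ (Q₀⁻¹ t)).2`. [folklore] -/
def bVec (z : ℂ) : ℂ × (ℂ →L[ℝ] ℂ) →L[ℝ] ℂ :=
  𝒥.nVec z 1 + (𝒥.nrm₀ z).comp (𝒥.nVec z I) +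
    (ContinuousLinearMap.snd ℝ ℂ ℂ).comp ((𝒥.K₀ z).comp ((𝒥.Qinv₀ z).comp
      (ContinuousLinearMap.fst ℝ ℂ (ℂ →L[ℝ] ℂ))))

/-- Pointwise formula for `bVec`. [folklore] -/
@[simp] theorem bVec_apply (z : ℂ) (x : ℂ × (ℂ →L[ℝ] ℂ)) :
    𝒥.bVec z x = 𝒥.nVec z 1 x + 𝒥.nrm₀ z (𝒥.nVec z I x) + (𝒥.K₀ z (𝒥.Qinv₀ z x.1)).2 := rfl

/-- **The coupling coefficient of the tangent row** (first order in the `f`-jet `(t, t')`):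
`m₀(z)(t, t') = B₀ n_I + (K₀ (Q₀⁻¹ t)).1 - (I/2) B₀ (n₁ + D₀ n_I + (K₀ (Q₀⁻¹ t)).2)`.
[cite: Wendl2018, Thm. 2.46] -/
def mCoeff₀ (z : ℂ) : ℂ × (ℂ →L[ℝ] ℂ) →L[ℝ] ℂ :=
  (𝒥.off₀ z).comp (𝒥.nVec z I) +
    (ContinuousLinearMap.fst ℝ ℂ ℂ).comp ((𝒥.K₀ z).comp ((𝒥.Qinv₀ z).comp
      (ContinuousLinearMap.fst ℝ ℂ (ℂ →L[ℝ] ℂ)))) -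
    ((2⁻¹ * I : ℂ) • (𝒥.off₀ z).comp (𝒥.bVec z))

/-- Pointwise formula for `mCoeff₀`. [folklore] -/
theorem mCoeff₀_apply (z : ℂ) (x : ℂ × (ℂ →L[ℝ] ℂ)) :
    𝒥.mCoeff₀ z x = 𝒥.off₀ z (𝒥.nVec z I x) + (𝒥.K₀ z (𝒥.Qinv₀ z x.1)).1 -
      2⁻¹ * I * 𝒥.off₀ z (𝒥.bVec z x) := by
  simp [mCoeff₀, smul_eq_mul]

/-! ### Smoothness of the coefficient field `a₀` -/

/-- `nrm₀` is smooth. [folklore] -/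
theorem contDiff_nrm₀ : ContDiff ℝ ∞ 𝒥.nrm₀ := by
  unfold nrm₀
  refine ContDiff.clm_comp contDiff_const (ContDiff.clm_comp ?_ contDiff_const)
  exact 𝒥.smooth₀.comp (contDiff_id.prodMk contDiff_const)

/-- `K₀` is smooth in `z`. [folklore] -/
theorem contDiff_K₀ : ContDiff ℝ ∞ 𝒥.K₀ := by
  unfold K₀
  refine ContDiff.clm_comp contDiff_const (ContDiff.clm_comp ?_ contDiff_const)
  have h : ContDiff ℝ ∞ (fderiv ℝ 𝒥.J₀) := 𝒥.smooth₀.fderiv_right (m := ∞) le_rfl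
  exact h.comp (contDiff_id.prodMk contDiff_const)

/-- **The coefficient field `a₀` is smooth.** [folklore] -/
theorem contDiff_aCoeff₀ : ContDiff ℝ ∞ 𝒥.aCoeff₀ := by
  unfold aCoeff₀
  have hQ : ContDiff ℝ ∞ 𝒥.Q₀ := 𝒥.contDiff_Q₀
  have hQi : ContDiff ℝ ∞ 𝒥.Qinv₀ := 𝒥.contDiff_Qinv₀_and.1
  have hD : ContDiff ℝ ∞ (fderiv ℝ 𝒥.Qinv₀) := hQi.fderiv_right (m := ∞) le_rfl
  have hD1 : ContDiff ℝ ∞ fun z => fderiv ℝ 𝒥.Qinv₀ z 1 := hD.clm_apply contDiff_const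
  have hDI : ContDiff ℝ ∞ fun z => fderiv ℝ 𝒥.Qinv₀ z I := hD.clm_apply contDiff_const
  refine hQ.clm_comp ((hD1.add (𝒥.contDiff_nrm₀.clm_comp hDI)).add ?_)
  exact ContDiff.clm_comp contDiff_const (𝒥.contDiff_K₀.clm_comp hQi)

/-! ### Evaluation of the variation formula at the zero section -/

section Eval

variable {δξ δf : ℂ → ℂ} {z : ℂ}

/-- The variation field at the zero section, `η z' = (δξ z', Q₀⁻¹ z' (δf z'))`, has derivative
`e ↦ (D δξ e, Q₀⁻¹ (D δf e) + (∂_e Q₀⁻¹) (δf z))`. [folklore] -/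
theorem hasFDerivAt_eta_zero (hξ : DifferentiableAt ℝ δξ z) (hf : DifferentiableAt ℝ δf z) :
    HasFDerivAt (fun z' => ((δξ z', 𝒥.Qinv₀ z' (δf z')) : ℂ × ℂ))
      ((fderiv ℝ δξ z).prod ((𝒥.Qinv₀ z).comp (fderiv ℝ δf z) +
        (fderiv ℝ 𝒥.Qinv₀ z).flip (δf z))) z := by
  have hQ : HasFDerivAt 𝒥.Qinv₀ (fderiv ℝ 𝒥.Qinv₀ z) z :=
    ((𝒥.contDiff_Qinv₀_and.1.differentiable (by simp)).differentiableAt).hasFDerivAt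
  exact hξ.hasFDerivAt.prodMk (hQ.clm_apply hf.hasFDerivAt)

/-- Pointwise derivative of the variation field at the zero section. [folklore] -/
theorem fderiv_eta_zero_apply (hξ : DifferentiableAt ℝ δξ z) (hf : DifferentiableAt ℝ δf z)
    (e : ℂ) :
    fderiv ℝ (fun z' => ((δξ z', 𝒥.Qinv₀ z' (δf z')) : ℂ × ℂ)) z e =
      (fderiv ℝ δξ z e, 𝒥.nVec z e (δf z, fderiv ℝ δf z)) := by
  rw [(𝒥.hasFDerivAt_eta_zero hξ hf).fderiv]
  simp [nVec_apply]

/-- The zero section `z ↦ (z, 0)` of chart `0` has derivative `inl`. [folklore] -/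
theorem fderiv_vmap₀_zero (z : ℂ) :
    fderiv ℝ (𝒥.vmap₀ 0 0) z = ContinuousLinearMap.inl ℝ ℂ ℂ := by
  have h : 𝒥.vmap₀ 0 0 = fun z : ℂ => ((z, 0) : ℂ × ℂ) := funext fun z => 𝒥.vmap₀_zero z
  rw [h]
  exact (hasFDerivAt_prodMk_left z (0 : ℂ)).fderiv

/-- **Normal row of the linearisation at the zero section**: the second component of
`Φ₀ [D η 1 + J₀ (D η I) + (D J₀ [η]) (I, 0)]` is `∂ₓ δf + I ∂_y δf + a₀(z) (δf z)` — it does not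
involve `δξ`. [cite: Wendl2018, Thm. 2.46] -/
theorem linearisation_zero_snd (hξ : DifferentiableAt ℝ δξ z) (hf : DifferentiableAt ℝ δf z) :
    (𝒥.Phi₀ 0 0 z
      (fderiv ℝ (fun z' => ((δξ z', 𝒥.Qinv₀ z' (δf z')) : ℂ × ℂ)) z 1 +
        𝒥.J₀ (𝒥.vmap₀ 0 0 z) (fderiv ℝ (fun z' => ((δξ z', 𝒥.Qinv₀ z' (δf z')) : ℂ × ℂ)) z I) +
        (fderiv ℝ 𝒥.J₀ (𝒥.vmap₀ 0 0 z) (δξ z, 𝒥.Qinv₀ z (δf z)))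
          (fderiv ℝ (𝒥.vmap₀ 0 0) z I))).2 =
      fderiv ℝ δf z 1 + I * fderiv ℝ δf z I + 𝒥.aCoeff₀ z (δf z) := by
  rw [𝒥.fderiv_eta_zero_apply hξ hf, 𝒥.fderiv_eta_zero_apply hξ hf, 𝒥.fderiv_vmap₀_zero,
    ContinuousLinearMap.inl_apply, 𝒥.vmap₀_zero, 𝒥.fderiv_J₀_apply_axis, 𝒥.J₀_axis_apply,
    Phi₀_eq_PhiJet₀]
  simp only [Pi.zero_apply]
  rw [𝒥.PhiJet₀_zero_apply_snd]
  simp only [Prod.snd_add, nVec_apply, aCoeff₀_apply, map_add, 𝒥.Q₀_Qinv₀, 𝒥.Q₀_nrm₀]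
  ring

/-- **Tangent row of the linearisation at the zero section**: the first component is
`∂ₓ δξ + I ∂_y δξ + m₀(z) (δf z, D δf z)` — Cauchy–Riemann in `δξ` with NO zeroth-order term in
`δξ`, plus a first-order coupling to `δf`. [cite: Wendl2018, Thm. 2.46] -/
theorem linearisation_zero_fst (hξ : DifferentiableAt ℝ δξ z) (hf : DifferentiableAt ℝ δf z) :
    (𝒥.Phi₀ 0 0 z
      (fderiv ℝ (fun z' => ((δξ z', 𝒥.Qinv₀ z' (δf z')) : ℂ × ℂ)) z 1 +
        𝒥.J₀ (𝒥.vmap₀ 0 0 z) (fderiv ℝ (fun z' => ((δξ z', 𝒥.Qinv₀ z' (δf z')) : ℂ × ℂ)) z I) +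
        (fderiv ℝ 𝒥.J₀ (𝒥.vmap₀ 0 0 z) (δξ z, 𝒥.Qinv₀ z (δf z)))
          (fderiv ℝ (𝒥.vmap₀ 0 0) z I))).1 =
      fderiv ℝ δξ z 1 + I * fderiv ℝ δξ z I + 𝒥.mCoeff₀ z (δf z, fderiv ℝ δf z) := by
  rw [𝒥.fderiv_eta_zero_apply hξ hf, 𝒥.fderiv_eta_zero_apply hξ hf, 𝒥.fderiv_vmap₀_zero,
    ContinuousLinearMap.inl_apply, 𝒥.vmap₀_zero, 𝒥.fderiv_J₀_apply_axis, 𝒥.J₀_axis_apply,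
    Phi₀_eq_PhiJet₀]
  simp only [Pi.zero_apply]
  rw [𝒥.PhiJet₀_zero_apply_fst]
  simp only [Prod.fst_add, Prod.snd_add, nVec_apply, bVec_apply, mCoeff₀_apply, map_add]
  ring

end Eval

end SphereACData

end SphereCR

end Literature.Geometry.Symplectic

end
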